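import Mathlib.Analysis.Complex.Basic
import Mathlib.LinearAlgebra.Complex.Module
import Mathlib.LinearAlgebra.TensorProduct.Tower
import Mathlib.LinearAlgebra.TensorProduct.Prod
import Mathlib.LinearAlgebra.BilinearForm.TensorProduct
import Mathlib.Algebra.Ring.NegOnePow
import Mathlib.LinearAlgebra.Dimension.Finrank
import Mathlib.RingTheory.Flat.Basic
import Mathlib.Order.SupIndep
import HarnessLib

-- provenance: harness21/H21/H21/Prelude/MotiveAbstract/HodgeStructure.lean @ aac78b6 (interim HEAD d8f2665); M5 mechanical rewrite
/-!
# Pure `ℚ`-Hodge structures (trunk `MotiveAbstract`, item C5)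

A pure `ℚ`-Hodge structure of weight `n` on a `ℚ`-vector space `V` is a decreasing, finite,
exhaustive filtration `F` of the complexification `V_ℂ = ℂ ⊗[ℚ] V` by `ℂ`-subspaces which is
`n`-opposed to its complex conjugate: `F^p ⊕ conj(F^q) = V_ℂ` whenever `p + q = n + 1`
(Deligne, *Théorie de Hodge II*, §1.2.4–1.2.5 and Déf. 2.1.4/2.1.10; Voisin, *Hodge Theory and
Complex Algebraic Geometry I*, §7.1.1). The Hodge pieces are `V^{p,q} = F^p ∩ conj(F^q)` for
`p + q = n` and `0` otherwise (Deligne, Hodge II, 1.2.5).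

We work purely linear-algebraically: `V : Type*` with `[AddCommGroup V] [Module ℚ V]`, the
complexification is Mathlib's `ℂ ⊗[ℚ] V` (no new type), and complex conjugation on it is
`HodgeStructure.conj := (Complex.conjAe restricted to ℚ) ⊗ id`.

## Main definitions

* `Literature.AlgebraicGeometry.Motives.HodgeStructure.conj`, `Literature.AlgebraicGeometry.Motives.HodgeStructure.complexConj`: complex conjugation on `ℂ ⊗[ℚ] V`
  and on its `ℂ`-subspaces; `Literature.HodgeStructure.ofRat : V →ₗ[ℚ] ℂ ⊗[ℚ] V`.
* `Literature.HodgeStructure V n`: pure `ℚ`-Hodge structures of weight `n` (Hodge filtration form).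
* `Literature.AlgebraicGeometry.Motives.HodgeStructure.piece`, `hodgeNumber`, `hodgeClasses`, `level`, `IsEffective`.
* `Literature.AlgebraicGeometry.Motives.HodgeStructure.Hom`, `Literature.AlgebraicGeometry.Motives.HodgeStructure.SubHodgeStructure`.
* Examples `Literature.HodgeStructure.tate j` (the Tate structure `ℚ(j)`, weight `-2j`, type `(-j,-j)`),
  `ofWeightZero`, `prod`.
* `Literature.AlgebraicGeometry.Motives.HodgeStructure.Polarization`, `IsPolarizable`, with the **untwisted** sign convention
  `i^{p-q} Q(x, conj x) > 0` (Voisin I §7.1.2; Peters–Steenbrink Def. 2.9); see the docstring of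
  `Polarization` for the comparison with Deligne, Hodge II, 2.1.15.

## Mathlib

Mathlib (at the pinned commit) has no Hodge structures (`rg HodgeStructure` in Mathlib: nothing).
We use `Complex.conjAe`, `LinearMap.rTensor`, `LinearMap.baseChange`,
`LinearMap.BilinForm.baseChange`, `TensorProduct.prodRight`, `Int.negOnePow`, `iSupIndep`.
-/

open scoped TensorProduct

noncomputable section

namespace Literature.AlgebraicGeometry.Motives

universe u v

variable {V : Type u} [AddCommGroup V] [Module ℚ V]
variable {W : Type v} [AddCommGroup W] [Module ℚ W]

namespace HodgeStructure

/-! ### Complex conjugation on the complexification -/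

/-- Complex conjugation on the complexification `ℂ ⊗[ℚ] V` of a `ℚ`-vector space, i.e.
`conj ⊗ id`. It is `ℚ`-linear and `ℂ`-antilinear (`conj_smul`).
(Deligne, *Théorie de Hodge II*, 2.1.4: the real structure underlying a Hodge structure.)
Name clash: the notation `conj` of `open ComplexConjugate` (for `starRingEnd`) shadows this
name; consumers opening both should write `HodgeStructure.conj`. [folklore] -/
def conj : ℂ ⊗[ℚ] V →ₗ[ℚ] ℂ ⊗[ℚ] V :=
  (Complex.conjAe.toLinearMap.restrictScalars ℚ).rTensor V

/-- `conj (c ⊗ v) = conj c ⊗ v`. [folklore] -/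
@[simp]
theorem conj_tmul (c : ℂ) (v : V) : conj (c ⊗ₜ[ℚ] v) = (starRingEnd ℂ c) ⊗ₜ[ℚ] v := rfl

/-- `conj` is `ℂ`-antilinear (Deligne, Hodge II, 2.1.4). [folklore] -/
theorem conj_smul (c : ℂ) (x : ℂ ⊗[ℚ] V) : conj (c • x) = starRingEnd ℂ c • conj x := by
  induction x using TensorProduct.induction_on with
  | zero => simp
  | tmul a v => simp [TensorProduct.smul_tmul']
  | add x y hx hy => simp [smul_add, map_add, hx, hy]

/-- `conj` is an involution (Deligne, Hodge II, 2.1.4). [folklore] -/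
@[simp]
theorem conj_conj (x : ℂ ⊗[ℚ] V) : conj (conj x) = x := by
  induction x using TensorProduct.induction_on with
  | zero => simp
  | tmul a v => simp
  | add x y hx hy => simp [map_add, hx, hy]

/-- `conj` commutes with the base change of any `ℚ`-linear map. [folklore] -/
theorem conj_baseChange (f : V →ₗ[ℚ] W) (x : ℂ ⊗[ℚ] V) :
    conj (f.baseChange ℂ x) = f.baseChange ℂ (conj x) := by
  induction x using TensorProduct.induction_on with
  | zero => simp
  | tmul a v => simp
  | add x y hx hy => simp [map_add, hx, hy]

/-- The complex conjugate `conj(W)` of a `ℂ`-subspace `W ⊆ ℂ ⊗[ℚ] V`: the preimage of `W` under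
`conj` (equal to its image, `conj` being an involution). It is again a `ℂ`-subspace since `conj`
is antilinear. This lives in the namespace `Literature.AlgebraicGeometry.Motives.HodgeStructure` (not in Mathlib's `Submodule`).
(Deligne, Hodge II, 1.2.4, 2.1.4.) [folklore] -/
def complexConj (W : Submodule ℂ (ℂ ⊗[ℚ] V)) : Submodule ℂ (ℂ ⊗[ℚ] V) where
  carrier := conj ⁻¹' W
  zero_mem' := by simp
  add_mem' {x y} hx hy := by
    simp only [Set.mem_preimage, SetLike.mem_coe, map_add] at hx hy ⊢
    exact W.add_mem hx hy
  smul_mem' c {x} hx := by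
    simp only [Set.mem_preimage, SetLike.mem_coe] at hx ⊢
    rw [conj_smul]
    exact W.smul_mem _ hx

/-- Membership in the conjugate subspace. [folklore] -/
@[simp]
theorem mem_complexConj {W : Submodule ℂ (ℂ ⊗[ℚ] V)} {x : ℂ ⊗[ℚ] V} :
    x ∈ complexConj W ↔ conj x ∈ W := Iff.rfl

/-- Complex conjugation of subspaces is an involution. [folklore] -/
@[simp]
theorem complexConj_complexConj (W : Submodule ℂ (ℂ ⊗[ℚ] V)) :
    complexConj (complexConj W) = W := by
  ext x; simp

/-- Complex conjugation of subspaces is monotone. [folklore] -/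
theorem complexConj_mono {W₁ W₂ : Submodule ℂ (ℂ ⊗[ℚ] V)} (h : W₁ ≤ W₂) :
    complexConj W₁ ≤ complexConj W₂ := fun _ hx => h hx

/-- The conjugate of everything is everything. [folklore] -/
@[simp]
theorem complexConj_top : complexConj (⊤ : Submodule ℂ (ℂ ⊗[ℚ] V)) = ⊤ := by
  ext x; simp

/-- The conjugate of zero is zero. [folklore] -/
@[simp]
theorem complexConj_bot : complexConj (⊥ : Submodule ℂ (ℂ ⊗[ℚ] V)) = ⊥ := by
  ext x
  simp only [mem_complexConj, Submodule.mem_bot]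
  constructor
  · intro h; simpa using congrArg conj h
  · intro h; simp [h]

/-- Conjugation of subspaces commutes with intersections. [folklore] -/
theorem complexConj_inf (W₁ W₂ : Submodule ℂ (ℂ ⊗[ℚ] V)) :
    complexConj (W₁ ⊓ W₂) = complexConj W₁ ⊓ complexConj W₂ := by
  ext x; simp

/-- Complex conjugation of subspaces as an order isomorphism of the subspace lattice. [folklore] -/
def complexConjOrderIso : Submodule ℂ (ℂ ⊗[ℚ] V) ≃o Submodule ℂ (ℂ ⊗[ℚ] V) where
  toFun := complexConj
  invFun := complexConj
  left_inv := complexConj_complexConj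
  right_inv := complexConj_complexConj
  map_rel_iff' {W₁ W₂} := by
    refine ⟨fun h => ?_, complexConj_mono⟩
    simpa using complexConj_mono (V := V) h

/-- `complexConjOrderIso` is `complexConj`. [folklore] -/
@[simp]
theorem complexConjOrderIso_apply (W : Submodule ℂ (ℂ ⊗[ℚ] V)) :
    complexConjOrderIso W = complexConj W := rfl

/-- Conjugation of subspaces commutes with sums. [folklore] -/
theorem complexConj_sup (W₁ W₂ : Submodule ℂ (ℂ ⊗[ℚ] V)) :
    complexConj (W₁ ⊔ W₂) = complexConj W₁ ⊔ complexConj W₂ :=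
  complexConjOrderIso.map_sup W₁ W₂

/-- Complex conjugation commutes with pulling back along a base-changed `ℚ`-linear map. [folklore] -/
theorem complexConj_comap_baseChange (f : V →ₗ[ℚ] W) (U : Submodule ℂ (ℂ ⊗[ℚ] W)) :
    complexConj (U.comap (f.baseChange ℂ)) = (complexConj U).comap (f.baseChange ℂ) := by
  ext x; simp [conj_baseChange]

/-- The inclusion `V → ℂ ⊗[ℚ] V`, `v ↦ 1 ⊗ v`, of a `ℚ`-vector space in its complexification. [folklore] -/
def ofRat : V →ₗ[ℚ] ℂ ⊗[ℚ] V := TensorProduct.mk ℚ ℂ V 1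

/-- `ofRat v = 1 ⊗ v`. [folklore] -/
@[simp]
theorem ofRat_apply (v : V) : ofRat v = (1 : ℂ) ⊗ₜ[ℚ] v := rfl

/-- Rational vectors are real: fixed by `conj`. (Not `@[simp]`: `simp` proves it from
`ofRat_apply` and `conj_tmul`.) [folklore] -/
theorem conj_ofRat (v : V) : conj (ofRat v) = ofRat v := by simp

end HodgeStructure

/-! ### Hodge structures -/

/-- A **pure `ℚ`-Hodge structure of weight `n`** on the `ℚ`-vector space `V`, given by its Hodge
filtration: a decreasing filtration `F` of `V_ℂ = ℂ ⊗[ℚ] V` by `ℂ`-subspaces, indexed by `ℤ`,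
which is finite (`F p = ⊤` for some `p` and `F p = ⊥` for some `p`) and such that `F` and its
complex conjugate are `n`-opposed: `F p ⊕ conj (F q) = V_ℂ` whenever `p + q = n + 1`.
(Deligne, *Théorie de Hodge II*, 1.2.4–1.2.5, Déf. 2.1.4 and 2.1.10; Voisin, *Hodge Theory I*,
§7.1.1, Def. 7.3 in filtration form.) No finite-dimensionality is imposed on `V`. [folklore] -/
@[ext]
structure HodgeStructure (V : Type u) [AddCommGroup V] [Module ℚ V] (n : ℤ) where
  /-- The Hodge filtration `F^p V_ℂ`. -/
  F : ℤ → Submodule ℂ (ℂ ⊗[ℚ] V)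
  /-- The Hodge filtration is decreasing. -/
  antitone_F : Antitone F
  /-- The Hodge filtration is exhaustive: some `F p` is everything. -/
  exists_F_eq_top : ∃ p, F p = ⊤
  /-- The Hodge filtration is separated: some `F p` is zero. -/
  exists_F_eq_bot : ∃ p, F p = ⊥
  /-- `F` and `conj F` are `n`-opposed (Deligne, Hodge II, 1.2.5). -/
  isCompl_F_complexConj : ∀ p q, p + q = n + 1 → IsCompl (F p) (HodgeStructure.complexConj (F q))

namespace HodgeStructure

variable {n : ℤ}

/-- The Hodge piece `V^{p,q}` of a Hodge structure of weight `n`: `F^p ∩ conj (F^q)` if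
`p + q = n`, and `0` otherwise (Deligne, Hodge II, 1.2.5, verbatim: "`A^{p,q} = F^p ∩ conj F^q`
pour `p + q = n`, `A^{p,q} = 0` sinon"; Voisin I, §7.1.1). The guard matters: off the line
`p + q = n` the intersection `F^p ∩ conj F^q` need not vanish (e.g. it is everything for
`p, q ≪ 0`), whereas `h^{p,q} = 0` there. See `piece_of_add_eq`, `piece_eq_bot_of_add_ne`. [folklore] -/
def piece (H : HodgeStructure V n) (p q : ℤ) : Submodule ℂ (ℂ ⊗[ℚ] V) :=
  if p + q = n then H.F p ⊓ complexConj (H.F q) else ⊥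

/-- On the line `p + q = n`, `V^{p,q} = F^p ∩ conj F^q` (Deligne, Hodge II, 1.2.5). [folklore] -/
@[simp]
theorem piece_of_add_eq (H : HodgeStructure V n) {p q : ℤ} (h : p + q = n) :
    H.piece p q = H.F p ⊓ complexConj (H.F q) := if_pos h

/-- `V^{p,q} = 0` unless `p + q = n` (Deligne, Hodge II, 1.2.5). [folklore] -/
@[simp]
theorem piece_eq_bot_of_add_ne (H : HodgeStructure V n) {p q : ℤ} (h : p + q ≠ n) :
    H.piece p q = ⊥ := if_neg h

/-- Membership in `V^{p,q}` for `p + q = n`: `x ∈ F^p` and `conj x ∈ F^q`. [folklore] -/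
theorem mem_piece_iff (H : HodgeStructure V n) {p q : ℤ} (h : p + q = n) {x : ℂ ⊗[ℚ] V} :
    x ∈ H.piece p q ↔ x ∈ H.F p ∧ conj x ∈ H.F q := by
  rw [piece_of_add_eq H h]
  rfl

/-- `V^{p,q} ⊆ F^p`. [folklore] -/
theorem piece_le_F (H : HodgeStructure V n) (p q : ℤ) : H.piece p q ≤ H.F p := by
  unfold piece
  split_ifs
  exacts [inf_le_left, bot_le]

/-- `V^{p,q} ⊆ conj F^q`. [folklore] -/
theorem piece_le_complexConj_F (H : HodgeStructure V n) (p q : ℤ) :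
    H.piece p q ≤ complexConj (H.F q) := by
  unfold piece
  split_ifs
  exacts [inf_le_right, bot_le]

/-- Hodge symmetry: `conj V^{p,q} = V^{q,p}` (Voisin I, §7.1.1). [folklore] -/
theorem complexConj_piece (H : HodgeStructure V n) (p q : ℤ) :
    complexConj (H.piece p q) = H.piece q p := by
  unfold piece
  rw [add_comm q p]
  split_ifs
  · rw [complexConj_inf, complexConj_complexConj, inf_comm]
  · exact complexConj_bot

/-- The Hodge pieces `V^{p,n-p}` are independent (Deligne, Hodge II, 1.2.5: `F` and `conj F`
`n`-opposed gives the bigrading `V_ℂ = ⊕ V^{p,q}`). [cite: DeligneHodgeII1971, 1.2.5] -/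
def iSupIndep_piece : Prop :=
  ∀ (H : HodgeStructure V n),
    iSupIndep fun p : ℤ => H.piece p (n - p)

/-- The Hodge decomposition `V_ℂ = ⊕_{p+q=n} V^{p,q}` spans (Deligne, Hodge II, 1.2.5;
Voisin I, §7.1.1). [cite: DeligneHodgeII1971, 1.2.5] -/
def iSup_piece_eq_top : Prop :=
  ∀ (H : HodgeStructure V n),
    ⨆ p : ℤ, H.piece p (n - p) = ⊤

/-- The Hodge filtration is recovered from the Hodge decomposition:
`F^p = ⊕_{i ≥ p} V^{i,n-i}` (Deligne, Hodge II, 1.2.5; Voisin I, §7.1.1). [cite: DeligneHodgeII1971, 1.2.5] -/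
def F_eq_iSup_piece : Prop :=
  ∀ (H : HodgeStructure V n) (p : ℤ),
    H.F p = ⨆ (i : ℤ) (_ : p ≤ i), H.piece i (n - i)

/-- The Hodge number `h^{p,q} = dim_ℂ V^{p,q}` (Voisin I, §7.1.1); it is `0` off the line
`p + q = n` (`piece_eq_bot_of_add_ne`). Junk value `0` if the piece is infinite-dimensional. [folklore] -/
def hodgeNumber (H : HodgeStructure V n) (p q : ℤ) : ℕ :=
  Module.finrank ℂ (H.piece p q)

/-- Hodge symmetry of Hodge numbers `h^{p,q} = h^{q,p}` (Voisin I, §7.1.1; `conj` restricts to a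
conjugate-linear bijection `V^{p,q} ≃ V^{q,p}`). [cite: VoisinHodgeI2002, §7.1.1] -/
def hodgeNumber_symm : Prop :=
  ∀ (H : HodgeStructure V n) (p q : ℤ),
    H.hodgeNumber p q = H.hodgeNumber q p

/-- `conj` maps `V^{p,q}` into `V^{q,p}` (Voisin I, §7.1.1, Def. 7.4: `conj V^{p,q} = V^{q,p}`).
[cite: VoisinHodgeI2002, §7.1.1 Def. 7.4] -/
theorem conj_mem_piece (H : HodgeStructure V n) {p q : ℤ} {x : ℂ ⊗[ℚ] V} (hx : x ∈ H.piece p q) :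
    conj x ∈ H.piece q p := by
  rw [← mem_complexConj, complexConj_piece]
  exact hx

/-- Complex conjugation restricted to the Hodge pieces, as an additive equivalence
`V^{p,q} ≃+ V^{q,p}`; it is `ℂ`-antilinear (`conjPieceEquiv_smul`)
(Voisin I, §7.1.1, Def. 7.4). [cite: VoisinHodgeI2002, §7.1.1 Def. 7.4] -/
def conjPieceEquiv (H : HodgeStructure V n) (p q : ℤ) : H.piece p q ≃+ H.piece q p where
  toFun x := ⟨conj x.1, conj_mem_piece H x.2⟩
  invFun x := ⟨conj x.1, conj_mem_piece H x.2⟩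
  left_inv x := by ext; simp
  right_inv x := by ext; simp
  map_add' x y := by ext; simp [map_add]

/-- `conjPieceEquiv` is `conj` on underlying vectors. [folklore] -/
@[simp]
theorem coe_conjPieceEquiv (H : HodgeStructure V n) (p q : ℤ) (x : H.piece p q) :
    (conjPieceEquiv H p q x : ℂ ⊗[ℚ] V) = conj x := rfl

/-- `conjPieceEquiv` is `ℂ`-antilinear. [folklore] -/
theorem conjPieceEquiv_smul (H : HodgeStructure V n) (p q : ℤ) (c : ℂ) (x : H.piece p q) :
    conjPieceEquiv H p q (c • x) = starRingEnd ℂ c • conjPieceEquiv H p q x := by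
  ext
  simp [conj_smul]

/-- **Hodge symmetry** `h^{p,q} = h^{q,p}`, discharging the named fact `hodgeNumber_symm`: complex
conjugation is a `conj`-semilinear bijection `V^{p,q} ≃ V^{q,p}` (`conjPieceEquiv`), and the rank
of a vector space is invariant under semilinear bijections over a ring automorphism
(`rank_eq_of_equiv_equiv`). Source: Voisin, *Hodge Theory and Complex Algebraic Geometry I*,
§7.1.1, Def. 7.4 (`V^{p,q} = conj V^{q,p}`), whence `h^{p,q} = h^{q,p}` as used in §6.3.1/§7
("by Hodge symmetry, `h^{k,l} = h^{l,k}`"). Off the line `p + q = n` both sides are `0`.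
[cite: VoisinHodgeI2002, §7.1.1 Def. 7.4] -/
theorem hodgeNumber_symm_holds : hodgeNumber_symm (V := V) (n := n) := by
  intro H p q
  unfold hodgeNumber Module.finrank
  rw [rank_eq_of_equiv_equiv (starRingEnd ℂ) (conjPieceEquiv H p q)
    (Function.Involutive.bijective fun c => starRingEnd_self_apply c) (conjPieceEquiv_smul H p q)]

/-- The rational classes of filtration level `p`: `V ∩ F^p V_ℂ`. For `n = 2p` these are the
**Hodge classes** `V ∩ V^{p,p}` (Deligne, Hodge II, 2.1; Voisin I, §7.1 and §11.3). [folklore] -/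
def hodgeClasses (H : HodgeStructure V n) (p : ℤ) : Submodule ℚ V :=
  ((H.F p).restrictScalars ℚ).comap ofRat

/-- Membership in `hodgeClasses`: `1 ⊗ v ∈ F^p`. [folklore] -/
theorem mem_hodgeClasses_iff (H : HodgeStructure V n) (p : ℤ) (v : V) :
    v ∈ H.hodgeClasses p ↔ ofRat v ∈ H.F p := Iff.rfl

/-- In weight `n = 2p`, a rational class in `F^p` lies in `V^{p,p}` (it is fixed by `conj`):
these are the Hodge classes (Voisin I, §7.1 and §11.3). [folklore] -/
theorem ofRat_mem_piece_of_mem_hodgeClasses (H : HodgeStructure V n) {p : ℤ} (hn : p + p = n)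
    {v : V} (hv : v ∈ H.hodgeClasses p) : ofRat v ∈ H.piece p p := by
  rw [mem_piece_iff H hn, conj_ofRat]
  exact ⟨hv, hv⟩

/-- Hodge symmetry of Hodge numbers off the line is trivial: both vanish. [folklore] -/
theorem hodgeNumber_eq_zero_of_add_ne (H : HodgeStructure V n) {p q : ℤ} (h : p + q ≠ n) :
    H.hodgeNumber p q = 0 := by
  rw [hodgeNumber, piece_eq_bot_of_add_ne H h, finrank_bot]

/-- The level of a Hodge structure: `max {|p - q| : V^{p,q} ≠ 0}` (Grothendieck, *Hodge's general
conjecture is false for trivial reasons*, 1969; used in the generalized Hodge conjecture).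
Junk value `0` if the set is unbounded (cannot happen) or empty (`V = 0`). [folklore] -/
def level (H : HodgeStructure V n) : ℕ :=
  sSup {m : ℕ | ∃ p q : ℤ, p + q = n ∧ H.piece p q ≠ ⊥ ∧ m = (p - q).natAbs}

/-- A Hodge structure is effective if its nonzero Hodge pieces `V^{p,q}` (`p + q = n`) have
`p, q ≥ 0`, i.e. `h^{p,q} ≠ 0 → p, q ≥ 0` (Deligne, Hodge II, 2.1 and 2.2; Voisin I, §7.1). Since
`piece p q = ⊥` for `p + q ≠ n` (`piece_eq_bot_of_add_ne`), no guard `p + q = n` is needed. [folklore] -/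
def IsEffective (H : HodgeStructure V n) : Prop :=
  ∀ p q : ℤ, H.piece p q ≠ ⊥ → 0 ≤ p ∧ 0 ≤ q

/-! ### Morphisms -/

/-- A morphism of Hodge structures of the same weight: a `ℚ`-linear map whose complexification
is compatible with the Hodge filtrations (Deligne, Hodge II, 2.1.6 / 2.3; Voisin I, §7.3.1). [folklore] -/
@[ext]
structure Hom (H₁ : HodgeStructure V n) (H₂ : HodgeStructure W n) where
  /-- The underlying `ℚ`-linear map. -/
  toLinearMap : V →ₗ[ℚ] W
  /-- The complexified map sends `F^p` into `F^p`. -/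
  map_F_le : ∀ p, (H₁.F p).map (toLinearMap.baseChange ℂ) ≤ H₂.F p

namespace Hom

/-- The identity morphism of a Hodge structure. [folklore] -/
def id (H : HodgeStructure V n) : Hom H H where
  toLinearMap := LinearMap.id
  map_F_le p := by simp [LinearMap.baseChange_id]

universe w in
/-- Composition of morphisms of Hodge structures. [folklore] -/
def comp {U : Type w} [AddCommGroup U] [Module ℚ U] {H₁ : HodgeStructure V n}
    {H₂ : HodgeStructure W n} {H₃ : HodgeStructure U n} (g : Hom H₂ H₃) (f : Hom H₁ H₂) :
    Hom H₁ H₃ where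
  toLinearMap := g.toLinearMap ∘ₗ f.toLinearMap
  map_F_le p := by
    rw [LinearMap.baseChange_comp, Submodule.map_comp]
    exact (Submodule.map_mono (f.map_F_le p)).trans (g.map_F_le p)

/-- Morphisms of Hodge structures are strict for the Hodge filtration:
`f(F^p V₁) = F^p V₂ ∩ im f` (Deligne, Hodge II, Thm. 1.2.10 (iii) and 2.3.5). [cite: DeligneHodgeII1971, Thm. 1.2.10(iii) and 2.3.5] -/
def strict : Prop :=
  ∀ {H₁ : HodgeStructure V n} {H₂ : HodgeStructure W n} (f : Hom H₁ H₂) (p : ℤ),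
    (H₁.F p).map (f.toLinearMap.baseChange ℂ) =
      H₂.F p ⊓ LinearMap.range (f.toLinearMap.baseChange ℂ)

end Hom

/-! ### Sub-Hodge structures -/

/-- A sub-Hodge structure of `H`: a `ℚ`-subspace `W ⊆ V` such that the filtration induced on
`W_ℂ` by `F` is again `n`-opposed to its conjugate, i.e. `W_ℂ = ⊕ (W_ℂ ∩ V^{p,q})`
(Deligne, Hodge II, 2.1; Voisin I, §7.3.1, Def. 7.24). The opposedness is stated for the
pull-backs along `W.subtype.baseChange ℂ : ℂ ⊗[ℚ] W →ₗ[ℂ] ℂ ⊗[ℚ] V`. [folklore] -/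
structure SubHodgeStructure (H : HodgeStructure V n) where
  /-- The underlying `ℚ`-subspace. -/
  toSubmodule : Submodule ℚ V
  /-- The induced filtration on `W_ℂ` is `n`-opposed to its complex conjugate. -/
  isCompl : ∀ p q, p + q = n + 1 →
    IsCompl ((H.F p).comap (toSubmodule.subtype.baseChange ℂ))
      ((complexConj (H.F q)).comap (toSubmodule.subtype.baseChange ℂ))

/-- Base change to `ℂ` of an injective `ℚ`-linear map is injective (`ℂ` is flat over `ℚ`;
Mathlib has `Module.Flat.lTensor_preserves_injective_linearMap` but no `LinearMap.baseChange`
form at the pin). Private: generic linear algebra, only used for `SubHodgeStructure`. [folklore] -/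
private theorem baseChange_injective {f : V →ₗ[ℚ] W} (hf : Function.Injective f) :
    Function.Injective (f.baseChange ℂ) := by
  rw [LinearMap.baseChange_eq_ltensor]
  exact Module.Flat.lTensor_preserves_injective_linearMap f hf

namespace SubHodgeStructure

variable {H : HodgeStructure V n}

/-- The Hodge structure on (the underlying space of) a sub-Hodge structure, with filtration the
pull-back of `F` along `W_ℂ → V_ℂ` (Voisin I, §7.3.1). [folklore] -/
def toHodgeStructure (S : SubHodgeStructure H) : HodgeStructure S.toSubmodule n where
  F p := (H.F p).comap (S.toSubmodule.subtype.baseChange ℂ)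
  antitone_F _ _ h := Submodule.comap_mono (H.antitone_F h)
  exists_F_eq_top := by
    obtain ⟨p, hp⟩ := H.exists_F_eq_top
    exact ⟨p, by simp [hp]⟩
  exists_F_eq_bot := by
    obtain ⟨p, hp⟩ := H.exists_F_eq_bot
    refine ⟨p, ?_⟩
    rw [hp, Submodule.comap_bot]
    exact LinearMap.ker_eq_bot.2 (baseChange_injective S.toSubmodule.injective_subtype)
  isCompl_F_complexConj p q h := by
    rw [complexConj_comap_baseChange]
    exact S.isCompl p q h

/-- The level of a sub-Hodge structure (that of its induced Hodge structure). [folklore] -/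
def level (S : SubHodgeStructure H) : ℕ := S.toHodgeStructure.level

end SubHodgeStructure

/-! ### Examples -/

/-- The one-step filtration `F p = ⊤` for `p ≤ k`, `F p = ⊥` for `p > k`, of a Hodge structure
purely of type `(k, k)`. [folklore] -/
def pureFiltration (V : Type u) [AddCommGroup V] [Module ℚ V] (k p : ℤ) :
    Submodule ℂ (ℂ ⊗[ℚ] V) :=
  if p ≤ k then ⊤ else ⊥

/-- Below the step the one-step filtration is everything. [folklore] -/
theorem pureFiltration_of_le {k p : ℤ} (h : p ≤ k) : pureFiltration V k p = ⊤ := if_pos h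

/-- Above the step the one-step filtration is zero. [folklore] -/
theorem pureFiltration_of_lt {k p : ℤ} (h : k < p) : pureFiltration V k p = ⊥ :=
  if_neg (not_le.2 h)

/-- The one-step filtration is decreasing. [folklore] -/
theorem antitone_pureFiltration (k : ℤ) : Antitone (pureFiltration V k) := by
  intro p q hpq
  by_cases hq : q ≤ k
  · rw [pureFiltration_of_le hq, pureFiltration_of_le (hpq.trans hq)]
  · rw [pureFiltration_of_lt (not_le.1 hq)]
    exact bot_le

/-- The one-step filtration at `k` is `2k`-opposed to its conjugate. [folklore] -/
theorem isCompl_pureFiltration (k : ℤ) {m p q : ℤ} (hm : m = 2 * k) (h : p + q = m + 1) :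
    IsCompl (pureFiltration V k p) (complexConj (pureFiltration V k q)) := by
  subst hm
  by_cases hp : p ≤ k
  · have hq : k < q := by omega
    rw [pureFiltration_of_le hp, pureFiltration_of_lt hq, complexConj_bot]
    exact isCompl_top_bot
  · have hq : q ≤ k := by omega
    rw [pureFiltration_of_lt (not_le.1 hp), pureFiltration_of_le hq, complexConj_top]
    exact isCompl_bot_top

/-- The Hodge structure on `V` purely of type `(k, k)` (weight `m = 2k`): `F p = V_ℂ` for
`p ≤ k` and `0` otherwise. The weight is a parameter `m` with `m = 2 * k` to avoid transport. [folklore] -/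
def pure (V : Type u) [AddCommGroup V] [Module ℚ V] (k m : ℤ) (hm : m = 2 * k) :
    HodgeStructure V m where
  F := pureFiltration V k
  antitone_F := antitone_pureFiltration k
  exists_F_eq_top := ⟨k, pureFiltration_of_le le_rfl⟩
  exists_F_eq_bot := ⟨k + 1, pureFiltration_of_lt (lt_add_one k)⟩
  isCompl_F_complexConj _ _ h := isCompl_pureFiltration k hm h

/-- The filtration of `pure`. [folklore] -/
@[simp]
theorem pure_F (k m : ℤ) (hm : m = 2 * k) (p : ℤ) :
    (pure V k m hm).F p = pureFiltration V k p := rfl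

/-- The **Tate Hodge structure** `ℚ(j)`: underlying space `ℚ` (informally `(2πi)^j ℚ`), weight
`-2j`, purely of type `(-j, -j)` (Deligne, Hodge II, 2.1.13). [folklore] -/
def tate (j : ℤ) : HodgeStructure ℚ (-2 * j) := pure ℚ (-j) (-2 * j) (by ring)

/-- The Hodge filtration of `ℚ(j)`: `F p = ⊤` for `p ≤ -j`, `⊥` otherwise. [folklore] -/
@[simp]
theorem tate_F (j p : ℤ) : (tate j).F p = pureFiltration ℚ (-j) p := rfl

/-- The trivial Hodge structure of weight `0` on `V`, purely of type `(0, 0)`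
(Deligne, Hodge II, 2.1.13 with `j = 0`, on any `V`). [folklore] -/
def ofWeightZero (V : Type u) [AddCommGroup V] [Module ℚ V] : HodgeStructure V 0 :=
  pure V 0 0 (by ring)

/-- The Hodge filtration of `ofWeightZero`. [folklore] -/
@[simp]
theorem ofWeightZero_F (p : ℤ) : (ofWeightZero V).F p = pureFiltration V 0 p := rfl

/-- The only possibly nonzero Hodge piece of `pure V k m` is `V^{k,k}`. [folklore] -/
theorem piece_pure_eq_bot {k m : ℤ} (hm : m = 2 * k) {p q : ℤ} (h : ¬(p = k ∧ q = k)) :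
    (pure V k m hm).piece p q = ⊥ := by
  by_cases hpq : p + q = m
  · rw [piece_of_add_eq _ hpq, pure_F, pure_F]
    have h' : k < p ∨ k < q := by omega
    rcases h' with h' | h'
    · rw [pureFiltration_of_lt h', bot_inf_eq]
    · rw [pureFiltration_of_lt h', complexConj_bot, inf_bot_eq]
  · exact piece_eq_bot_of_add_ne _ hpq

/-- A Hodge structure purely of type `(k, k)` with `0 ≤ k` is effective. [folklore] -/
theorem isEffective_pure {k m : ℤ} (hm : m = 2 * k) (hk : 0 ≤ k) : (pure V k m hm).IsEffective := by
  intro p q hne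
  by_contra h
  exact hne (piece_pure_eq_bot hm fun ⟨hp, hq⟩ => h ⟨hp ▸ hk, hq ▸ hk⟩)

/-- The trivial weight-`0` Hodge structure is effective (sanity check for `IsEffective`). [folklore] -/
theorem isEffective_ofWeightZero : (ofWeightZero V).IsEffective := isEffective_pure _ le_rfl

/-- Off the line `p + q = 0` the pieces of `ofWeightZero` vanish, e.g. `V^{-1,-1} = 0`. -/
example : (ofWeightZero V).piece (-1) (-1) = ⊥ := piece_eq_bot_of_add_ne _ (by decide)

/-- The `ℂ`-linear identification `ℂ ⊗ (V × W) ≃ (ℂ ⊗ V) × (ℂ ⊗ W)` used for direct sums. [folklore] -/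
def prodEquiv (V : Type u) [AddCommGroup V] [Module ℚ V] (W : Type v) [AddCommGroup W]
    [Module ℚ W] : ℂ ⊗[ℚ] (V × W) ≃ₗ[ℂ] (ℂ ⊗[ℚ] V) × (ℂ ⊗[ℚ] W) :=
  TensorProduct.prodRight ℚ ℂ ℂ V W

/-- `conj` on `ℂ ⊗ (V × W)` is componentwise under `prodEquiv`. [folklore] -/
theorem conj_prodEquiv_symm (x : ℂ ⊗[ℚ] V) (y : ℂ ⊗[ℚ] W) :
    conj ((prodEquiv V W).symm (x, y)) = (prodEquiv V W).symm (conj x, conj y) := by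
  have hx : ∀ x : ℂ ⊗[ℚ] V,
      conj ((prodEquiv V W).symm (x, 0)) = (prodEquiv V W).symm (conj x, 0) := by
    intro x
    induction x using TensorProduct.induction_on with
    | zero => simp [← Prod.zero_eq_mk]
    | tmul a v =>
      have : ((a ⊗ₜ[ℚ] v, 0) : (ℂ ⊗[ℚ] V) × (ℂ ⊗[ℚ] W)) = prodEquiv V W (a ⊗ₜ (v, 0)) := by
        simp [prodEquiv]
      have h' : ((starRingEnd ℂ a ⊗ₜ[ℚ] v, 0) : (ℂ ⊗[ℚ] V) × (ℂ ⊗[ℚ] W)) =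
          prodEquiv V W (starRingEnd ℂ a ⊗ₜ (v, 0)) := by
        simp [prodEquiv]
      rw [this, LinearEquiv.symm_apply_apply, conj_tmul, conj_tmul, h', LinearEquiv.symm_apply_apply]
    | add x y hx hy =>
      have : ((x + y, 0) : (ℂ ⊗[ℚ] V) × (ℂ ⊗[ℚ] W)) = (x, 0) + (y, 0) := by simp
      rw [this, map_add, map_add, hx, hy, ← map_add, Prod.mk_add_mk, ← map_add, add_zero]
  have hy : ∀ y : ℂ ⊗[ℚ] W,
      conj ((prodEquiv V W).symm (0, y)) = (prodEquiv V W).symm (0, conj y) := by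
    intro y
    induction y using TensorProduct.induction_on with
    | zero => simp [← Prod.zero_eq_mk]
    | tmul a w =>
      have : ((0, a ⊗ₜ[ℚ] w) : (ℂ ⊗[ℚ] V) × (ℂ ⊗[ℚ] W)) = prodEquiv V W (a ⊗ₜ (0, w)) := by
        simp [prodEquiv]
      have h' : ((0, starRingEnd ℂ a ⊗ₜ[ℚ] w) : (ℂ ⊗[ℚ] V) × (ℂ ⊗[ℚ] W)) =
          prodEquiv V W (starRingEnd ℂ a ⊗ₜ (0, w)) := by
        simp [prodEquiv]
      rw [this, LinearEquiv.symm_apply_apply, conj_tmul, conj_tmul, h', LinearEquiv.symm_apply_apply]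
    | add x y hx hy =>
      have : ((0, x + y) : (ℂ ⊗[ℚ] V) × (ℂ ⊗[ℚ] W)) = (0, x) + (0, y) := by simp
      rw [this, map_add, map_add, hx, hy, ← map_add, Prod.mk_add_mk, ← map_add, add_zero]
  have : ((x, y) : (ℂ ⊗[ℚ] V) × (ℂ ⊗[ℚ] W)) = (x, 0) + (0, y) := by simp
  rw [this, map_add, map_add, hx, hy, ← map_add, Prod.mk_add_mk, add_zero, zero_add]

/-- Conjugation is compatible with products of subspaces under `prodEquiv`. [folklore] -/
theorem complexConj_comap_prod (A : Submodule ℂ (ℂ ⊗[ℚ] V)) (B : Submodule ℂ (ℂ ⊗[ℚ] W)) :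
    complexConj ((A.prod B).comap (prodEquiv V W : ℂ ⊗[ℚ] (V × W) →ₗ[ℂ] _)) =
      ((complexConj A).prod (complexConj B)).comap
        (prodEquiv V W : ℂ ⊗[ℚ] (V × W) →ₗ[ℂ] _) := by
  ext z
  obtain ⟨⟨x, y⟩, rfl⟩ := (prodEquiv V W).symm.surjective z
  simp only [Submodule.mem_comap, mem_complexConj, LinearEquiv.coe_coe, conj_prodEquiv_symm,
    LinearEquiv.apply_symm_apply, Submodule.mem_prod]

/-- The direct sum of two Hodge structures of the same weight (Deligne, Hodge II, 2.1). [folklore] -/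
def prod (H₁ : HodgeStructure V n) (H₂ : HodgeStructure W n) : HodgeStructure (V × W) n where
  F p := ((H₁.F p).prod (H₂.F p)).comap (prodEquiv V W : ℂ ⊗[ℚ] (V × W) →ₗ[ℂ] _)
  antitone_F _ _ h :=
    Submodule.comap_mono (Submodule.prod_mono (H₁.antitone_F h) (H₂.antitone_F h))
  exists_F_eq_top := by
    obtain ⟨p₁, h₁⟩ := H₁.exists_F_eq_top
    obtain ⟨p₂, h₂⟩ := H₂.exists_F_eq_top
    refine ⟨min p₁ p₂, ?_⟩
    have e₁ : H₁.F (min p₁ p₂) = ⊤ := eq_top_iff.2 (h₁ ▸ H₁.antitone_F (min_le_left _ _))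
    have e₂ : H₂.F (min p₁ p₂) = ⊤ := eq_top_iff.2 (h₂ ▸ H₂.antitone_F (min_le_right _ _))
    rw [e₁, e₂, Submodule.prod_top, Submodule.comap_top]
  exists_F_eq_bot := by
    obtain ⟨p₁, h₁⟩ := H₁.exists_F_eq_bot
    obtain ⟨p₂, h₂⟩ := H₂.exists_F_eq_bot
    refine ⟨max p₁ p₂, ?_⟩
    have e₁ : H₁.F (max p₁ p₂) = ⊥ := eq_bot_iff.2 (h₁ ▸ H₁.antitone_F (le_max_left _ _))
    have e₂ : H₂.F (max p₁ p₂) = ⊥ := eq_bot_iff.2 (h₂ ▸ H₂.antitone_F (le_max_right _ _))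
    rw [e₁, e₂, Submodule.prod_bot, Submodule.comap_bot]
    exact LinearEquiv.ker _
  isCompl_F_complexConj p q h := by
    rw [complexConj_comap_prod]
    refine ((Submodule.orderIsoMapComap (prodEquiv V W)).symm.isCompl_iff).1 ?_
    obtain ⟨hinf, hsup⟩ := H₁.isCompl_F_complexConj p q h
    obtain ⟨hinf', hsup'⟩ := H₂.isCompl_F_complexConj p q h
    refine ⟨?_, ?_⟩
    · rw [disjoint_iff] at hinf hinf' ⊢
      rw [Submodule.prod_inf_prod, hinf, hinf', Submodule.prod_bot]
    · rw [codisjoint_iff] at hsup hsup' ⊢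
      rw [Submodule.prod_sup_prod, hsup, hsup', Submodule.prod_top]

/-! ### Polarizations -/

/-- A **polarization** of the weight-`n` Hodge structure `H`: a `ℚ`-bilinear form `Q` on `V`,
`(-1)^n`-symmetric, whose complexification `Q_ℂ` satisfies the Hodge–Riemann bilinear
relations: `Q_ℂ(F^p, F^{n+1-p}) = 0`, and `i^{p-q} Q_ℂ(x, conj x) > 0` (real and positive) for
`0 ≠ x ∈ V^{p,q}`.

**Sign convention.** This is the *untwisted* convention `i^{p-q} Q(x, conj x) > 0` of Voisin,
*Hodge Theory I*, §7.1.2 (polarized Hodge structures) = Peters–Steenbrink, *Mixed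
Hodge Structures*, Def. 2.9. It equals Deligne, *Théorie de Hodge II*, 2.1.15, with the factor
`(2πi)^n` removed: up to the positive real `(2π)^n` the two conditions differ by `i^n`, i.e. by
the sign `-1` exactly when `n ≡ 2 mod 4`. Every consumer in H21 (`isPolarizable_tate`,
`BettiHodgeData.polarizable`) uses the present convention. Here `i^p` is `Complex.I ^ (p : ℤ)`
(`zpow`). [folklore] -/
structure Polarization (H : HodgeStructure V n) where
  /-- The underlying `ℚ`-bilinear form `Q`. -/
  form : LinearMap.BilinForm ℚ V
  /-- `Q` is `(-1)^n`-symmetric: `Q(y, x) = (-1)^n Q(x, y)`. -/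
  flip_form : form.flip = ((n.negOnePow : ℤˣ) : ℤ) • form
  /-- First Hodge–Riemann relation: `F^p` and `F^{n+1-p}` are `Q_ℂ`-orthogonal. -/
  form_apply_eq_zero : ∀ p : ℤ, ∀ x ∈ H.F p, ∀ y ∈ H.F (n + 1 - p), form.baseChange ℂ x y = 0
  /-- Second Hodge–Riemann relation: `i^{p-q} Q_ℂ(x, conj x)` is a positive real for
  `0 ≠ x ∈ V^{p,q}` (untwisted convention). -/
  pos : ∀ p q : ℤ, p + q = n → ∀ x ∈ H.piece p q, x ≠ 0 →
    ∃ r : ℝ, 0 < r ∧ Complex.I ^ p * (Complex.I ^ q)⁻¹ * form.baseChange ℂ x (conj x) = r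

/-- A Hodge structure is polarizable if it admits a polarization (Deligne, Hodge II, 2.1.15;
Voisin I, §7.1.2). [folklore] -/
def IsPolarizable (H : HodgeStructure V n) : Prop := Nonempty (Polarization H)

/-- Every element of `ℂ ⊗[ℚ] ℚ` is `c ⊗ 1` with `c = TensorProduct.rid ℚ ℂ x` (a restatement of
`(TensorProduct.rid ℚ ℂ).symm_apply_apply`, only used in `Polarization.tate`). [folklore] -/
private theorem eq_rid_tmul_one (x : ℂ ⊗[ℚ] ℚ) : x = (TensorProduct.rid ℚ ℂ x) ⊗ₜ[ℚ] (1 : ℚ) := by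
  conv_lhs => rw [← (TensorProduct.rid ℚ ℂ).symm_apply_apply x]
  rfl

/-- In the Tate structure `ℚ(j)`, a nonzero Hodge piece `V^{p,q}` with `p + q = -2j` has
`p = q = -j`. [folklore] -/
theorem eq_of_mem_piece_tate {j p q : ℤ} (hpq : p + q = -2 * j) {x : ℂ ⊗[ℚ] ℚ}
    (hx : x ∈ (tate j).piece p q) (hx0 : x ≠ 0) : p = -j ∧ q = -j := by
  rw [mem_piece_iff _ hpq] at hx
  by_contra hne
  have h : -j < p ∨ -j < q := by omega
  apply hx0
  rcases h with h | h
  · have : x ∈ (tate j).F p := hx.1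
    rwa [tate_F, pureFiltration_of_lt h, Submodule.mem_bot] at this
  · have : x ∈ complexConj ((tate j).F q) := hx.2
    rwa [tate_F, pureFiltration_of_lt h, complexConj_bot, Submodule.mem_bot] at this

/-- The multiplication form `Q(x, y) = xy` polarizes the Tate structure `ℚ(j)` in the untwisted
convention: on `V^{-j,-j} = ℂ`, `i^0 Q(c, conj c) = |c|^2 > 0` (Deligne, Hodge II, 2.1.15;
Peters–Steenbrink, Ex. 2.10). [folklore] -/
def Polarization.tate (j : ℤ) : Polarization (tate j) where
  form := LinearMap.mul ℚ ℚ
  flip_form := by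
    have : (-2 * j).negOnePow = 1 := by
      rw [neg_mul, Int.negOnePow_neg, Int.negOnePow_two_mul]
    rw [this, Units.val_one, one_smul]
    ext
    simp
  form_apply_eq_zero p x hx y hy := by
    by_cases hp : p ≤ -j
    · have hq : -j < -2 * j + 1 - p := by omega
      rw [tate_F, pureFiltration_of_lt hq, Submodule.mem_bot] at hy
      simp [hy]
    · rw [tate_F, pureFiltration_of_lt (not_le.1 hp), Submodule.mem_bot] at hx
      simp [hx]
  pos p q hpq x hx hx0 := by
    obtain ⟨rfl, rfl⟩ := eq_of_mem_piece_tate hpq hx hx0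
    set c : ℂ := TensorProduct.rid ℚ ℂ x with hc
    have hxc : x = c ⊗ₜ[ℚ] (1 : ℚ) := eq_rid_tmul_one x
    have hc0 : c ≠ 0 := by
      rintro h0
      exact hx0 (by rw [hxc, h0, TensorProduct.zero_tmul])
    refine ⟨Complex.normSq c, Complex.normSq_pos.2 hc0, ?_⟩
    rw [mul_inv_cancel₀ (zpow_ne_zero _ Complex.I_ne_zero), one_mul, hxc, conj_tmul,
      LinearMap.BilinForm.baseChange_tmul]
    simp [Complex.mul_conj]

/-- The Tate structure `ℚ(j)` is polarizable (by `Q(x, y) = xy`, in the untwisted convention). [folklore] -/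
theorem isPolarizable_tate (j : ℤ) : IsPolarizable (tate j) := ⟨Polarization.tate j⟩

end HodgeStructure

end Literature.AlgebraicGeometry.Motives

end
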